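import Literature.Probability.LatticeModels.ScaleFrame
import Literature.Probability.LatticeModels.RandomClusterIsoInvariance
import HarnessLib

/-!
# Relabelling a scale frame along a bijection of vertex types (proved)

Topic `Literature/Probability/LatticeModels` (trunk `StatMech`, family `crit-ising`). The vocabulary of
`ScaleFrame.lean` (regions `inSet`, `annSet`, `outSet`, edge sets `edgesTouching`, events `radCross`,
`sepEvent`, RSW predicates `SepBound`, `NoCrossBound`, `RadialBound`, ladders `LadderRSWb`) is
invariant under relabelling the vertices along a bijection `e : V ≃ W`: a frame `F'` on `W` with
`F'.E = e(F.E)`, `F'.rad = F.rad ∘ e⁻¹`, `F'.good = e(F.good)` (such a frame exists,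
`ScaleFrame.exists_relabel`) has the relabelled regions and edge sets, its radial crossings and
separators are the relabelled events (`relabel_mem_radCross_iff`, `relabel_mem_sepEvent_iff`), and —
the random-cluster measure being invariant under graph isomorphisms
(`rcMeasure_real_preimage_relabel`) — it satisfies the same RSW bounds (`sepBound_rel`,
`noCrossBound_rel`, `radialBound_rel`, `ladderRSWb_rel`). This is used to move statements quantified
over frames in one universe to frames in another (e.g. `W = ULift (Fin n)`).

Everything is proved; no definitions, no named facts. [folklore]

## References

* H. Kesten, *Probab. Theory Related Fields* 73 (1986) 369–394, §2 (the annuli and their RSW bounds).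
* G. Grimmett, *The Random-Cluster Model*, Springer (2006), §4.3 (isomorphism invariance).
-/

open MeasureTheory Finset SimpleGraph
open Literature.Probability.Percolation (BondConfig openConnIn sym2Equiv sym2Equiv_apply
  sym2Equiv_symm relabel_mem_openConnIn relabel_symm_relabel mk_mem_relabel_iff)

namespace Literature.Probability.LatticeModels

namespace ScaleFrame

variable {V W : Type*} [Fintype V] [DecidableEq V] [Fintype W] [DecidableEq W]

/-! ### The relabelled frame -/

/-- **A scale frame can be relabelled along a bijection of vertex types**: there is a frame on `W`
with edges `e(F.E)`, radius `F.rad ∘ e⁻¹`, good set `e(F.good)` and the same modulus and ceiling.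
[folklore] -/
theorem exists_relabel (F : ScaleFrame V) (e : V ≃ W) :
    ∃ F' : ScaleFrame W, F'.E = F.E.map (sym2Equiv e).toEmbedding ∧
      (∀ w, F'.rad w = F.rad (e.symm w)) ∧ (∀ w, w ∈ F'.good ↔ e.symm w ∈ F.good) ∧
      F'.η = F.η ∧ F'.Rmax = F.Rmax := by
  refine ⟨⟨F.E.map (sym2Equiv e).toEmbedding, fun w => F.rad (e.symm w), e.symm ⁻¹' F.good, F.η,
    F.Rmax, F.η_pos, fun z hz u hu v hv hug huR => ?_⟩, rfl, fun _ => rfl, fun _ => Iff.rfl, rfl, rfl⟩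
  rw [Finset.mem_map_equiv] at hz
  exact F.adj_good _ hz (e.symm u) (Sym2.mem_map.2 ⟨u, hu, rfl⟩) (e.symm v)
    (Sym2.mem_map.2 ⟨v, hv, rfl⟩) hug huR

/-! ### Regions and edge sets -/

section Rel

variable {F : ScaleFrame V} {F' : ScaleFrame W} {e : V ≃ W}

/-- The relabelling relations are symmetric. [folklore] -/
theorem rel_symm (hE : F'.E = F.E.map (sym2Equiv e).toEmbedding)
    (hrad : ∀ w, F'.rad w = F.rad (e.symm w)) (hgood : ∀ w, w ∈ F'.good ↔ e.symm w ∈ F.good) :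
    F.E = F'.E.map (sym2Equiv e.symm).toEmbedding ∧ (∀ v, F.rad v = F'.rad (e.symm.symm v)) ∧
      (∀ v, v ∈ F.good ↔ e.symm.symm v ∈ F'.good) := by
  refine ⟨?_, fun v => by rw [hrad, e.symm_symm, e.symm_apply_apply],
    fun v => by rw [hgood, e.symm_symm, e.symm_apply_apply]⟩
  ext z
  rw [Finset.mem_map_equiv, hE, Finset.mem_map_equiv, sym2Equiv_symm, sym2Equiv_symm,
    Equiv.symm_symm, ← sym2Equiv_symm, Equiv.symm_apply_apply]

/-- Inside regions of the relabelled frame. [folklore] -/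
theorem mem_inSet_rel (hrad : ∀ w, F'.rad w = F.rad (e.symm w))
    (hgood : ∀ w, w ∈ F'.good ↔ e.symm w ∈ F.good) {s : ℝ} {w : W} :
    w ∈ F'.inSet s ↔ e.symm w ∈ F.inSet s := by
  rw [mem_inSet, mem_inSet, hrad, hgood]

/-- Annuli of the relabelled frame. [folklore] -/
theorem mem_annSet_rel (hrad : ∀ w, F'.rad w = F.rad (e.symm w))
    (hgood : ∀ w, w ∈ F'.good ↔ e.symm w ∈ F.good) {s s' : ℝ} {w : W} :
    w ∈ F'.annSet s s' ↔ e.symm w ∈ F.annSet s s' := by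
  rw [mem_annSet, mem_annSet, hrad, hgood]

/-- Outsides of the relabelled frame. [folklore] -/
theorem mem_outSet_rel (hrad : ∀ w, F'.rad w = F.rad (e.symm w))
    (hgood : ∀ w, w ∈ F'.good ↔ e.symm w ∈ F.good) {s s' : ℝ} {w : W} :
    w ∈ F'.outSet s s' ↔ e.symm w ∈ F.outSet s s' := by
  rw [mem_outSet, mem_outSet, Set.mem_union, Set.mem_union, mem_inSet_rel hrad hgood,
    mem_annSet_rel hrad hgood]

/-- Inside regions of the relabelled frame are images. [folklore] -/
theorem inSet_rel (hrad : ∀ w, F'.rad w = F.rad (e.symm w))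
    (hgood : ∀ w, w ∈ F'.good ↔ e.symm w ∈ F.good) (s : ℝ) : F'.inSet s = e '' F.inSet s := by
  rw [Equiv.image_eq_preimage_symm]
  ext w
  exact mem_inSet_rel hrad hgood

/-- Annuli of the relabelled frame are images. [folklore] -/
theorem annSet_rel (hrad : ∀ w, F'.rad w = F.rad (e.symm w))
    (hgood : ∀ w, w ∈ F'.good ↔ e.symm w ∈ F.good) (s s' : ℝ) :
    F'.annSet s s' = e '' F.annSet s s' := by
  rw [Equiv.image_eq_preimage_symm]
  ext w
  exact mem_annSet_rel hrad hgood

/-- Complements of annuli of the relabelled frame are images. [folklore] -/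
theorem compl_annSet_rel (hrad : ∀ w, F'.rad w = F.rad (e.symm w))
    (hgood : ∀ w, w ∈ F'.good ↔ e.symm w ∈ F.good) (s s' : ℝ) :
    (F'.annSet s s')ᶜ = e '' (F.annSet s s')ᶜ := by
  rw [Equiv.image_eq_preimage_symm, Set.preimage_compl]
  ext w
  exact not_congr (mem_annSet_rel hrad hgood)

/-- Edges of the relabelled frame. [folklore] -/
theorem mem_E_rel (hE : F'.E = F.E.map (sym2Equiv e).toEmbedding) {z : Sym2 W} :
    z ∈ F'.E ↔ Sym2.map e.symm z ∈ F.E := by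
  rw [hE, Finset.mem_map_equiv]
  rfl

/-- Edges touching relabelled sets are relabelled edges. [folklore] -/
theorem edgesTouching_rel (hE : F'.E = F.E.map (sym2Equiv e).toEmbedding) {A : Set V} {A' : Set W}
    (hA : ∀ w, w ∈ A' ↔ e.symm w ∈ A) :
    F'.edgesTouching A' = (F.edgesTouching A).map (sym2Equiv e).toEmbedding := by
  ext z
  rw [Finset.mem_map_equiv, mem_edgesTouching, mem_edgesTouching, mem_E_rel hE]
  constructor
  · rintro ⟨hz, v, hv, hva⟩
    exact ⟨hz, e.symm v, Sym2.mem_map.2 ⟨v, hv, rfl⟩, (hA v).1 hva⟩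
  · rintro ⟨hz, v, hv, hva⟩
    obtain ⟨w, hw, rfl⟩ := Sym2.mem_map.1 hv
    exact ⟨hz, w, hw, (hA w).2 hva⟩

/-- Edges touching an annulus of the relabelled frame. [folklore] -/
theorem edgesTouching_annSet_rel (hE : F'.E = F.E.map (sym2Equiv e).toEmbedding)
    (hrad : ∀ w, F'.rad w = F.rad (e.symm w)) (hgood : ∀ w, w ∈ F'.good ↔ e.symm w ∈ F.good)
    (s s' : ℝ) : F'.edgesTouching (F'.annSet s s') =
      (F.edgesTouching (F.annSet s s')).map (sym2Equiv e).toEmbedding :=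
  edgesTouching_rel hE fun _ => mem_annSet_rel hrad hgood

end Rel

/-! ### Graph isomorphisms and the invariance of the local measures -/

omit [Fintype V] [DecidableEq V] [Fintype W] [DecidableEq W] in
/-- The bijection `e` is an isomorphism from `⟨S⟩` onto `⟨e S⟩`. [folklore] -/
theorem exists_iso_fromEdgeSet (e : V ≃ W) (S : Finset (Sym2 V)) :
    ∃ φ : fromEdgeSet (↑S : Set (Sym2 V)) ≃g
      fromEdgeSet (↑(S.map (sym2Equiv e).toEmbedding) : Set (Sym2 W)), ∀ v, φ v = e v :=
  ⟨{ toEquiv := e, map_rel_iff' := fun {a b} => by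
      rw [fromEdgeSet_adj, fromEdgeSet_adj, Finset.mem_coe, Finset.mem_coe, Finset.mem_map_equiv,
        sym2Equiv_symm, show (sym2Equiv e.symm) s(e a, e b) = s(a, b) by
          rw [sym2Equiv_apply, Sym2.map_mk, e.symm_apply_apply, e.symm_apply_apply],
        e.injective.ne_iff] }, fun _ => rfl⟩

/-- **The local random-cluster measures are carried to each other by the relabelling**: for every
edge set `S`, wired set `B` and event `A'` of `W`-configurations,
`φ^{e B}_{⟨e S⟩}(A') = φ^B_{⟨S⟩}{ω | e ω ∈ A'}`. [cite: Grimmett2006, §4.3] -/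
theorem real_rel (e : V ≃ W) (S : Finset (Sym2 V)) {p q : ℝ} (hp : p ∈ Set.Icc (0 : ℝ) 1) (hq : 0 < q)
    (B : Set V) (A' : Set (BondConfig W)) :
    (rcMeasure (fromEdgeSet (↑(S.map (sym2Equiv e).toEmbedding) : Set (Sym2 W))) p q (e '' B)).real A' =
      (rcMeasure (fromEdgeSet (↑S : Set (Sym2 V))) p q B).real (BondConfig.relabel (sym2Equiv e) ⁻¹' A') := by
  obtain ⟨φ, hφ⟩ := exists_iso_fromEdgeSet e S
  have hφe : φ.toEquiv = e := Equiv.ext hφ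
  have h := rcMeasure_real_preimage_relabel φ hp hq B A'
  rw [hφe, show ((φ : V → W) '' B) = e '' B from congrArg (· '' B) (funext hφ)] at h
  exact h.symm

section Events

variable {F : ScaleFrame V} {F' : ScaleFrame W} {e : V ≃ W}

omit [Fintype V] [DecidableEq V] [Fintype W] [DecidableEq W] in
/-- The bijection `e` is an isomorphism of the graphs of the two frames. [folklore] -/
theorem exists_graphIso' {E : Finset (Sym2 V)} {E' : Finset (Sym2 W)}
    (hE : E' = E.map (sym2Equiv e).toEmbedding) :
    ∃ ψ : fromEdgeSet (↑E : Set (Sym2 V)) ≃g fromEdgeSet (↑E' : Set (Sym2 W)),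
      (∀ v, ψ.toHom v = e v) ∧ ∀ w, ψ.symm.toHom w = e.symm w := by
  subst hE
  obtain ⟨ψ, hψ⟩ := exists_iso_fromEdgeSet e E
  exact ⟨ψ, hψ, fun w => ψ.injective (show ψ (ψ.symm.toHom w) = ψ (e.symm w) by
    rw [hψ (e.symm w), e.apply_symm_apply]; exact ψ.apply_symm_apply w)⟩

/-- The bijection `e` is an isomorphism `F.graph ≃g F'.graph`. [folklore] -/
theorem exists_graphIso (hE : F'.E = F.E.map (sym2Equiv e).toEmbedding) :
    ∃ ψ : F.graph ≃g F'.graph, (∀ v, ψ.toHom v = e v) ∧ ∀ w, ψ.symm.toHom w = e.symm w :=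
  exists_graphIso' hE

/-- **Radial crossings are relabelled to radial crossings.** [cite: Kesten1986, §2] -/
theorem relabel_mem_radCross (hE : F'.E = F.E.map (sym2Equiv e).toEmbedding)
    (hrad : ∀ w, F'.rad w = F.rad (e.symm w)) (hgood : ∀ w, w ∈ F'.good ↔ e.symm w ∈ F.good)
    {s s' : ℝ} {ω : BondConfig V} (h : ω ∈ F.radCross s s') :
    BondConfig.relabel (sym2Equiv e) ω ∈ F'.radCross s s' := by
  obtain ⟨a, b, w, ha, hb, hsupp, hedges⟩ := h
  obtain ⟨ψ, hψ, -⟩ := exists_graphIso (e := e) hE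
  refine ⟨e a, e b, (w.map ψ.toHom).copy (hψ a) (hψ b), ?_, ?_, ?_, ?_⟩
  · exact (mem_inSet_rel hrad hgood).2 (by rw [e.symm_apply_apply]; exact ha)
  · exact (mem_outSet_rel hrad hgood).2 (by rw [e.symm_apply_apply]; exact hb)
  · intro z hz
    rw [Walk.support_copy, Walk.support_map, List.mem_map] at hz
    obtain ⟨v, hv, rfl⟩ := hz
    rw [hψ]
    rcases hsupp v hv with rfl | rfl | hv'
    · exact Or.inl rfl
    · exact Or.inr (Or.inl rfl)
    · exact Or.inr (Or.inr ((mem_annSet_rel hrad hgood).2 (by rw [e.symm_apply_apply]; exact hv')))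
  · intro z hz
    rw [Walk.edges_copy, Walk.edges_map, List.mem_map] at hz
    obtain ⟨d, hd, rfl⟩ := hz
    induction d using Sym2.ind with
    | h u v =>
      rw [Sym2.map_mk, hψ, hψ]
      exact (mk_mem_relabel_iff e ω u v).2 (hedges _ hd)

/-- **Open separators are relabelled to open separators.** [cite: Kesten1986, §2] -/
theorem relabel_mem_sepEvent (hE : F'.E = F.E.map (sym2Equiv e).toEmbedding)
    (hrad : ∀ w, F'.rad w = F.rad (e.symm w)) (hgood : ∀ w, w ∈ F'.good ↔ e.symm w ∈ F.good)
    {s s' : ℝ} {ω : BondConfig V} (h : ω ∈ F.sepEvent s s') :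
    BondConfig.relabel (sym2Equiv e) ω ∈ F'.sepEvent s s' := by
  obtain ⟨P, hP, hconn, hsep⟩ := h
  obtain ⟨ψ, -, hψs⟩ := exists_graphIso (e := e) hE
  refine ⟨e '' P, ?_, ?_, ?_⟩
  · rintro _ ⟨v, hv, rfl⟩
    exact (mem_annSet_rel hrad hgood).2 (by rw [e.symm_apply_apply]; exact hP hv)
  · rintro _ ⟨a, ha, rfl⟩ _ ⟨b, hb, rfl⟩
    rw [annSet_rel hrad hgood]
    exact relabel_mem_openConnIn e (hconn a ha b hb)
  · intro a' b' ha' hb' w'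
    have ha : e.symm a' ∈ F.inSet s := (mem_inSet_rel hrad hgood).1 ha'
    have hb : e.symm b' ∈ F.outSet s s' := (mem_outSet_rel hrad hgood).1 hb'
    obtain ⟨z, hz, hzP⟩ := hsep _ _ ha hb ((w'.map ψ.symm.toHom).copy (hψs a') (hψs b'))
    rw [Walk.support_copy, Walk.support_map, List.mem_map] at hz
    obtain ⟨z', hz', rfl⟩ := hz
    refine ⟨z', hz', ψ.symm.toHom z', hzP, ?_⟩
    rw [hψs, e.apply_symm_apply]

/-- **Relabelling identifies the radial-crossing events of the two frames.** [cite: Kesten1986, §2] -/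
theorem relabel_mem_radCross_iff (hE : F'.E = F.E.map (sym2Equiv e).toEmbedding)
    (hrad : ∀ w, F'.rad w = F.rad (e.symm w)) (hgood : ∀ w, w ∈ F'.good ↔ e.symm w ∈ F.good)
    {s s' : ℝ} {ω : BondConfig V} :
    BondConfig.relabel (sym2Equiv e) ω ∈ F'.radCross s s' ↔ ω ∈ F.radCross s s' := by
  refine ⟨fun h => ?_, relabel_mem_radCross hE hrad hgood⟩
  obtain ⟨hE', hrad', hgood'⟩ := rel_symm hE hrad hgood
  rw [← relabel_symm_relabel e ω]
  exact relabel_mem_radCross hE' hrad' hgood' h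

/-- **Relabelling identifies the separator events of the two frames.** [cite: Kesten1986, §2] -/
theorem relabel_mem_sepEvent_iff (hE : F'.E = F.E.map (sym2Equiv e).toEmbedding)
    (hrad : ∀ w, F'.rad w = F.rad (e.symm w)) (hgood : ∀ w, w ∈ F'.good ↔ e.symm w ∈ F.good)
    {s s' : ℝ} {ω : BondConfig V} :
    BondConfig.relabel (sym2Equiv e) ω ∈ F'.sepEvent s s' ↔ ω ∈ F.sepEvent s s' := by
  refine ⟨fun h => ?_, relabel_mem_sepEvent hE hrad hgood⟩
  obtain ⟨hE', hrad', hgood'⟩ := rel_symm hE hrad hgood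
  rw [← relabel_symm_relabel e ω]
  exact relabel_mem_sepEvent hE' hrad' hgood' h

/-- **Base walks are relabelled to base walks**: a walk of `⟨F.E⟩` through good vertices of radius
`< t` is carried to such a walk of `⟨F'.E⟩`. [folklore] -/
theorem exists_walk_rel (hE : F'.E = F.E.map (sym2Equiv e).toEmbedding)
    (hrad : ∀ w, F'.rad w = F.rad (e.symm w)) (hgood : ∀ w, w ∈ F'.good ↔ e.symm w ∈ F.good)
    {x x' : V} {t : ℝ} (h : ∃ w : (fromEdgeSet (↑F.E : Set (Sym2 V))).Walk x x',
      ∀ z ∈ w.support, z ∈ F.good ∧ F.rad z < t) :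
    ∃ w : (fromEdgeSet (↑F'.E : Set (Sym2 W))).Walk (e x) (e x'),
      ∀ z ∈ w.support, z ∈ F'.good ∧ F'.rad z < t := by
  obtain ⟨w, hw⟩ := h
  obtain ⟨ψ, hψ, -⟩ := exists_graphIso' (e := e) hE
  refine ⟨(w.map ψ.toHom).copy (hψ x) (hψ x'), fun z hz => ?_⟩
  rw [Walk.support_copy, Walk.support_map, List.mem_map] at hz
  obtain ⟨v, hv, rfl⟩ := hz
  rw [hψ, hgood, hrad, e.symm_apply_apply]
  exact hw v hv

/-! ### The RSW predicates and ladders are invariant -/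

/-- `SepBound` is carried to the relabelled frame. [cite: Kesten1986, §2 eq. (28)] -/
theorem sepBound_rel (hE : F'.E = F.E.map (sym2Equiv e).toEmbedding)
    (hrad : ∀ w, F'.rad w = F.rad (e.symm w)) (hgood : ∀ w, w ∈ F'.good ↔ e.symm w ∈ F.good)
    {p q c s s' : ℝ} (hp : p ∈ Set.Icc (0 : ℝ) 1) (hq : 0 < q) (h : F.SepBound p q c s s') :
    F'.SepBound p q c s s' := by
  unfold SepBound at h ⊢
  rw [edgesTouching_annSet_rel hE hrad hgood, ← Set.image_empty e, real_rel e _ hp hq,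
    show BondConfig.relabel (sym2Equiv e) ⁻¹' F'.sepEvent s s' = F.sepEvent s s' from
      Set.ext fun _ => relabel_mem_sepEvent_iff hE hrad hgood]
  exact h

/-- `NoCrossBound` is carried to the relabelled frame. [cite: Kesten1986, §2 eq. (28)] -/
theorem noCrossBound_rel (hE : F'.E = F.E.map (sym2Equiv e).toEmbedding)
    (hrad : ∀ w, F'.rad w = F.rad (e.symm w)) (hgood : ∀ w, w ∈ F'.good ↔ e.symm w ∈ F.good)
    {p q c s s' : ℝ} (hp : p ∈ Set.Icc (0 : ℝ) 1) (hq : 0 < q) (h : F.NoCrossBound p q c s s') :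
    F'.NoCrossBound p q c s s' := by
  unfold NoCrossBound at h ⊢
  rw [edgesTouching_annSet_rel hE hrad hgood, compl_annSet_rel hrad hgood, real_rel e _ hp hq,
    show BondConfig.relabel (sym2Equiv e) ⁻¹' F'.radCross s s' = F.radCross s s' from
      Set.ext fun _ => relabel_mem_radCross_iff hE hrad hgood]
  exact h

/-- `RadialBound` is carried to the relabelled frame. [cite: Kesten1986, §2 eqs. (26)–(27)] -/
theorem radialBound_rel (hE : F'.E = F.E.map (sym2Equiv e).toEmbedding)
    (hrad : ∀ w, F'.rad w = F.rad (e.symm w)) (hgood : ∀ w, w ∈ F'.good ↔ e.symm w ∈ F.good)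
    {p q c s s' : ℝ} (hp : p ∈ Set.Icc (0 : ℝ) 1) (hq : 0 < q) (h : F.RadialBound p q c s s') :
    F'.RadialBound p q c s s' := by
  unfold RadialBound at h ⊢
  rw [edgesTouching_annSet_rel hE hrad hgood, ← Set.image_empty e, real_rel e _ hp hq,
    show BondConfig.relabel (sym2Equiv e) ⁻¹' F'.radCross s s' = F.radCross s s' from
      Set.ext fun _ => relabel_mem_radCross_iff hE hrad hgood]
  exact h

/-- **RSW ladders are carried to the relabelled frame.** [cite: Kesten1986, §2 eqs. (26)–(28)] -/
theorem ladderRSWb_rel (hE : F'.E = F.E.map (sym2Equiv e).toEmbedding)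
    (hrad : ∀ w, F'.rad w = F.rad (e.symm w)) (hgood : ∀ w, w ∈ F'.good ↔ e.symm w ∈ F.good)
    {p q c a M : ℝ} {n b : ℕ} (hp : p ∈ Set.Icc (0 : ℝ) 1) (hq : 0 < q)
    (h : F.LadderRSWb p q c a M n b) : F'.LadderRSWb p q c a M n b := fun i j hij hj hb =>
  ⟨sepBound_rel hE hrad hgood hp hq (h i j hij hj hb).1,
    noCrossBound_rel hE hrad hgood hp hq (h i j hij hj hb).2.1,
    radialBound_rel hE hrad hgood hp hq (h i j hij hj hb).2.2⟩

end Events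

end ScaleFrame

end Literature.Probability.LatticeModels
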